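import Literature.Probability.LatticeModels.IsingMonotonicity
import Literature.Probability.LatticeModels.IsingFKG
import Literature.Probability.LatticeModels.GKSInequalities
import HarnessLib

/-!
# The plus state from FKG: existence on local observables and translation invariance

Sibling proof file of `Literature.Probability.LatticeModels.IsingMonotonicity` (finite-volume FKG
consequences). Following Friedli–Velenik 2017, §3.6.2–§3.7 (proof of Theorem 3.17), two of the
tree's standing named facts about the plus state `⟨·⟩⁺_{β,h}` of the nearest-neighbour Ising
model on `ℤ^d` are **discharged from the finite-volume FKG inequality** `ising_fkg` alone:

* `tendsto_isingExpect_plus_plusIndicator` — the increasing indicators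
  `n_B = ∏_{i∈B} (1+σ_i)/2` have nonincreasing (Lemma 3.22, from FKG) bounded plus expectations
  along boxes, hence converge (for every `h ∈ ℝ`), and every spin product is a finite linear
  combination of them (`spinProduct_eq_sum_plusIndicator`, Lemma 3.19) — Friedli–Velenik's own
  route to Thm. 3.17 (the existence of the plus state on spin products is the tree theorem
  `Literature.Probability.LatticeModels.hasBoxLimit_isingCorr_plus_holds` of `GKSInequalities`, by GKS);
* `plusExpect_spinProduct_comp_shift` — translation invariance of the plus state on spin
  products (Friedli–Velenik Thm. 3.17: "`⟨·⟩⁺_{β,h}` is invariant under translations"), by the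
  same decomposition, the translation covariance of the finite-volume plus measures
  (`isingExpect_plus_shift`) and the sandwich `B(L) + v ⊆ B(L + ‖v‖)`, `B(L) ⊆ B(L + ‖v‖) + v`;
  whence `plusExpect_spinAt_eq_spontaneousMagnetization` (`⟨σ_x⟩⁺ = m*`) and
  `⟨σ_xσ_y⟩⁺ = ⟨σ₀σ_{y-x}⟩⁺` without the infinite-volume plus measure `exists_plusMeasure`;
* with the tree theorems `ising_fkg_holds` (`IsingFKG`) and
  `Literature.Probability.LatticeModels.hasBoxLimit_isingCorr_plus_holds` (`GKSInequalities`), the unconditional discharges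
  `plusExpect_spinAt_eq_spontaneousMagnetization_holds`, `plusExpect_spinAt_mul_le_plusPair_holds`
  (`MagnetizationContinuity` facts) and `twoPointFree_le_twoPointPlus_holds` (`SharpnessProofs`
  fact).

## References

* S. Friedli, Y. Velenik, *Statistical Mechanics of Lattice Systems* (CUP 2017), §3.6.2
  (Lemma 3.19, Lemma 3.22), §3.7 (Theorem 3.17, Exercise 3.15).
-/

noncomputable section

open MeasureTheory Filter Topology Finset Literature.Probability.LatticeModels Literature.Probability.Percolation

namespace Literature.Probability.LatticeModels

section Algebra

variable {V : Type*}

/-- **Friedli–Velenik 2017, Lemma 3.19 for spin products**: every spin product is a finite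
linear combination of the increasing indicators `n_B = ∏_{i ∈ B}(1+σ_i)/2`, `B ⊆ A`:
`σ_A = ∏_{i∈A} (2 n_i - 1) = ∑_{B ⊆ A} (-1)^{|A∖B|} 2^{|B|} n_B`. [cite: FriedliVelenik2017, Lemma 3.19] -/
theorem spinProduct_eq_sum_plusIndicator [DecidableEq V] (A : Finset V) (σ : SpinConfig V) :
    spinProduct A σ = ∑ B ∈ A.powerset, ((-1 : ℝ) ^ #(A \ B) * 2 ^ #B) * plusIndicator B σ := by
  have h1 : spinProduct A σ = ∏ x ∈ A, (2 * ((1 + spinAt x σ) / 2) + (-1)) := by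
    unfold spinProduct
    exact prod_congr rfl fun x _ => by ring
  rw [h1, Finset.prod_add]
  refine sum_congr rfl fun B _ => ?_
  rw [Finset.prod_const, Finset.prod_mul_distrib, Finset.prod_const, plusIndicator]
  ring

/-- `n_B ≥ 0`. [folklore] -/
theorem plusIndicator_nonneg (S : Finset V) (σ : SpinConfig V) : 0 ≤ plusIndicator S σ := by
  rw [plusIndicator_eq]
  split_ifs <;> norm_num

end Algebra

/-! ### Translation covariance of finite-volume plus expectations on `ℤ^d` -/

section Shift

variable {d : ℕ}

/-- Membership in a translated volume: `y ∈ Λ + v ↔ y - v ∈ Λ`. [folklore] -/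
theorem mem_map_shift_iff' (Λ : Finset (Site d)) (v y : Site d) :
    y ∈ Λ.map (Site.shift v).toEmbedding ↔ y - v ∈ Λ := by
  rw [Finset.mem_map_equiv, Site.shift_symm_apply]

/-- The edges touching a translated volume are the translated edges touching the volume:
`ℰ^b_{Λ + v} = ℰ^b_Λ + v` on `ℤ^d`. (Friedli–Velenik 2017, §3.1, translation invariance.) [cite: FriedliVelenik2017, §3.1] -/
theorem edgesTouching_map_shift (Λ : Finset (Site d)) (v : Site d) :
    edgesTouching (zdGraph d) (Λ.map (Site.shift v).toEmbedding) =
      (edgesTouching (zdGraph d) Λ).map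
        ⟨Sym2.map (Site.shift v), Sym2.map.injective (Site.shift v).injective⟩ := by
  ext e
  rw [mem_edgesTouching_iff, Finset.mem_map]
  simp only [mem_map_shift_iff', Function.Embedding.coeFn_mk]
  induction e using Sym2.ind with
  | _ a b =>
    constructor
    · rintro ⟨hadj, x, hx, hxe⟩
      have hadj' : (zdGraph d).Adj (a - v) (b - v) := by
        rw [← zdGraph_adj_shift_iff v]
        simpa only [Site.shift_apply, sub_add_cancel] using (SimpleGraph.mem_edgeSet _).1 hadj
      refine ⟨s(a - v, b - v), ?_, ?_⟩
      · rw [mem_edgesTouching_iff]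
        refine ⟨(SimpleGraph.mem_edgeSet _).2 hadj', x - v, hx, ?_⟩
        rcases Sym2.mem_iff.1 hxe with rfl | rfl
        · exact Sym2.mem_mk_left _ _
        · exact Sym2.mem_mk_right _ _
      · rw [Sym2.map_mk, Site.shift_apply, Site.shift_apply, sub_add_cancel, sub_add_cancel]
    · rintro ⟨e₀, he₀, he⟩
      induction e₀ using Sym2.ind with
      | _ a₀ b₀ =>
        rw [mem_edgesTouching_iff] at he₀
        obtain ⟨hadj₀, x₀, hx₀, hx₀e⟩ := he₀
        have hadj' : (zdGraph d).Adj (a₀ + v) (b₀ + v) :=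
          (zdGraph_adj_shift_iff v a₀ b₀).2 ((SimpleGraph.mem_edgeSet _).1 hadj₀)
        rw [Sym2.map_mk, Site.shift_apply, Site.shift_apply] at he
        rw [← he]
        refine ⟨(SimpleGraph.mem_edgeSet _).2 hadj', x₀ + v, by simpa using hx₀, ?_⟩
        rcases Sym2.mem_iff.1 hx₀e with rfl | rfl
        · exact Sym2.mem_mk_left _ _
        · exact Sym2.mem_mk_right _ _

/-- The plus Hamiltonian is translation covariant:
`ℋ⁺_{Λ+v;h}(θ_v σ) = ℋ⁺_{Λ;h}(σ)` with `(θ_v σ)_y = σ_{y-v}`. (Friedli–Velenik 2017, §3.1.) [cite: FriedliVelenik2017, §3.1] -/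
theorem isingHamiltonian_plus_shift (Λ : Finset (Site d)) (v : Site d) (h : ℝ)
    (σ : SpinConfig (Site d)) :
    isingHamiltonian (zdGraph d) (Λ.map (Site.shift v).toEmbedding) h .plus (configShift v σ) =
      isingHamiltonian (zdGraph d) Λ h .plus σ := by
  have h1 : ∑ e ∈ (edgesTouching (zdGraph d) Λ).map
      ⟨Sym2.map (Site.shift v), Sym2.map.injective (Site.shift v).injective⟩,
        bondSpin (configShift v σ) e = ∑ e ∈ edgesTouching (zdGraph d) Λ, bondSpin σ e := by
    simp only [Finset.sum_map, Function.Embedding.coeFn_mk]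
    refine Finset.sum_congr rfl fun e _ => ?_
    induction e using Sym2.ind with
    | _ a b =>
      rw [Sym2.map_mk, Site.shift_apply, Site.shift_apply, bondSpin_mk, bondSpin_mk]
      simp [spinAt, configShift_apply]
  have h2 : ∑ x ∈ Λ.map (Site.shift v).toEmbedding, spinAt x (configShift v σ) =
      ∑ x ∈ Λ, spinAt x σ := by
    simp only [Finset.sum_map, Equiv.coe_toEmbedding, Site.shift_apply]
    refine Finset.sum_congr rfl fun x _ => ?_
    simp [spinAt, configShift_apply]
  simp only [isingHamiltonian, BoundaryCondition.plus, interactionEdges_fixed]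
  rw [edgesTouching_map_shift, h1, h2]

/-- **Translation covariance of finite-volume plus expectations on `ℤ^d`**:
`⟨F⟩⁺_{Λ+v;β,h} = ⟨F ∘ θ_v⟩⁺_{Λ;β,h}` for measurable `F`, `(θ_v σ)_y = σ_{y-v}`
(Friedli–Velenik 2017, §3.1, eq. (3.8), reindexed; the plus boundary condition is translation
invariant). [cite: FriedliVelenik2017, §3.1, eq. (3.8)] -/
theorem isingExpect_plus_shift (Λ : Finset (Site d)) (v : Site d) (β h : ℝ)
    {F : SpinConfig (Site d) → ℝ} (hF : Measurable F) :
    isingExpect (zdGraph d) (Λ.map (Site.shift v).toEmbedding) β h .plus F =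
      isingExpect (zdGraph d) Λ β h .plus (F ∘ configShift v) := by
  set Λ' := Λ.map (Site.shift v).toEmbedding with hΛ'
  have hmem : ∀ {y : Site d}, y ∈ Λ' → y - v ∈ Λ := fun hy => by
    rwa [hΛ', mem_map_shift_iff'] at hy
  have hmem' : ∀ {x : Site d}, x ∈ Λ → x + v ∈ Λ' := fun hx => by
    rw [hΛ', mem_map_shift_iff']; simpa using hx
  let e : (Λ → ℤˣ) ≃ (Λ' → ℤˣ) :=
    { toFun := fun τ y => τ ⟨y.1 - v, hmem y.2⟩
      invFun := fun τ' x => τ' ⟨x.1 + v, hmem' x.2⟩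
      left_inv := fun τ => funext fun x => by simp
      right_inv := fun τ' => funext fun y => by simp }
  have hglue : ∀ τ : Λ → ℤˣ, glue Λ' (e τ) .plus = configShift v (glue Λ τ .plus) := by
    intro τ
    funext y
    by_cases hy : y ∈ Λ'
    · rw [glue_apply_of_mem _ _ _ hy, configShift_apply, glue_apply_of_mem _ _ _ (hmem hy)]
      rfl
    · have hy' : y - v ∉ Λ := fun h' => hy (by simpa using hmem' h')
      rw [glue_apply_of_notMem _ _ _ hy, configShift_apply, glue_apply_of_notMem _ _ _ hy']
      rfl
  have hw : ∀ τ : Λ → ℤˣ, isingWeight (zdGraph d) Λ' β h .plus (e τ) =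
      isingWeight (zdGraph d) Λ β h .plus τ := by
    intro τ
    rw [isingWeight, isingWeight, hglue, hΛ', isingHamiltonian_plus_shift]
  have hFm : Measurable (F ∘ configShift v) := hF.comp (configShift v).measurable
  rw [isingExpect_eq_sum_div _ _ _ _ β hF, isingExpect_eq_sum_div _ _ _ _ β hFm,
    isingPartitionFunction, isingPartitionFunction, ← Equiv.sum_comp e, ← Equiv.sum_comp e]
  simp only [hw, hglue, Function.comp_apply]

/-- `B(L) + v ⊆ B(L + ‖v‖_∞)`. [folklore] -/
theorem map_shift_box_subset (L : ℕ) (v : Site d) :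
    (box d L).map (Site.shift v).toEmbedding ⊆ box d (L + Site.supNorm v) := by
  intro y hy
  rw [mem_map_shift_iff', mem_box_iff_supNorm_le] at hy
  rw [mem_box_iff_supNorm_le]
  have := Site.supNorm_add_le (y - v) v
  rw [sub_add_cancel] at this
  omega

/-- `B(L) ⊆ B(L + ‖v‖_∞) + v`. [folklore] -/
theorem box_subset_map_shift_box (L : ℕ) (v : Site d) :
    box d L ⊆ (box d (L + Site.supNorm v)).map (Site.shift v).toEmbedding := by
  intro y hy
  rw [mem_map_shift_iff', mem_box_iff_supNorm_le]
  rw [mem_box_iff_supNorm_le] at hy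
  have := Site.supNorm_add_le y (-v)
  have hneg : Site.supNorm (-v) = Site.supNorm v := by simp [Site.supNorm, Int.natAbs_neg]
  rw [← sub_eq_add_neg, hneg] at this
  omega

/-- Translations preserve the coordinatewise order of configurations. [folklore] -/
theorem configShift_monotone (v : Site d) : Monotone (configShift (S := ℤˣ) v) :=
  fun _ _ hle y => by simpa only [configShift_apply] using hle (y - v)

end Shift

end Literature.Probability.LatticeModels

namespace Literature.Probability.LatticeModels

open Percolation

variable {d : ℕ}

/-! ### Existence of the plus state on local observables (Friedli–Velenik, Thm. 3.17) -/

/-- **Plus expectations of an increasing indicator converge along boxes** (Friedli–Velenik 2017,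
proof of Thm. 3.17: `⟨n_B⟩⁺_{B(L);β,h}` is nonincreasing in `L` by Lemma 3.22 (FKG) and bounded
below by `0`), for `β ≥ 0` and every `h`; the limit is `plusExpect d β h (plusIndicator B)`. [cite: FriedliVelenik2017, Thm. 3.17 (proof) and Lemma 3.22] -/
theorem tendsto_isingExpect_plus_plusIndicator (hfkg : ∀ β : ℝ, ising_fkg (zdGraph d) (β := β))
    {β : ℝ} (hβ : 0 ≤ β) (h : ℝ) (B : Finset (Site d)) :
    Tendsto (fun L : ℕ => isingExpect (zdGraph d) (box d L) β h .plus (plusIndicator B)) atTop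
      (𝓝 (plusExpect d β h (plusIndicator B))) := by
  set a : ℕ → ℝ := fun L => isingExpect (zdGraph d) (box d L) β h .plus (plusIndicator B) with ha
  have hanti : Antitone a := fun L L' hLL' =>
    isingExpect_plus_anti_volume_of_fkg (zdGraph d) (hfkg β) hβ h (box_mono d hLL')
      (plusIndicator_mono B) (measurable_plusIndicator B)
  have hbdd : BddBelow (Set.range a) := by
    refine ⟨0, ?_⟩
    rintro _ ⟨L, rfl⟩
    exact integral_nonneg fun σ => plusIndicator_nonneg B σ
  have hconv := tendsto_atTop_ciInf hanti hbdd
  have hlim : plusExpect d β h (plusIndicator B) = ⨅ L, a L := hconv.limUnder_eq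
  rw [hlim]
  exact hconv

/-- **Translated increasing indicators**: for `β ≥ 0`, any `h`, `B` and `v`,
`⟨n_B ∘ θ_v⟩⁺_{B(L);β,h} = ⟨n_B⟩⁺_{B(L)+v;β,h} → ⟨n_B⟩⁺_{β,h}` as `L → ∞` (sandwich between
`⟨n_B⟩⁺_{B(L+‖v‖)}` and `⟨n_B⟩⁺_{B(L-‖v‖)}` by Lemma 3.22). (Friedli–Velenik 2017, Thm. 3.17,
translation invariance.) [cite: FriedliVelenik2017, Thm. 3.17 (proof)] -/
theorem tendsto_isingExpect_plus_plusIndicator_comp_shift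
    (hfkg : ∀ β : ℝ, ising_fkg (zdGraph d) (β := β)) {β : ℝ} (hβ : 0 ≤ β) (h : ℝ)
    (B : Finset (Site d)) (v : Site d) :
    Tendsto (fun L : ℕ => isingExpect (zdGraph d) (box d L) β h .plus (plusIndicator B ∘ configShift v))
      atTop (𝓝 (plusExpect d β h (plusIndicator B))) := by
  set m := Site.supNorm v with hm
  set a : ℕ → ℝ := fun L => isingExpect (zdGraph d) (box d L) β h .plus (plusIndicator B) with ha
  have hconv := tendsto_isingExpect_plus_plusIndicator hfkg hβ h B
  have hanti : ∀ {Λ₁ Λ₂ : Finset (Site d)}, Λ₁ ⊆ Λ₂ →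
      isingExpect (zdGraph d) Λ₂ β h .plus (plusIndicator B) ≤
        isingExpect (zdGraph d) Λ₁ β h .plus (plusIndicator B) := fun h12 =>
    isingExpect_plus_anti_volume_of_fkg (zdGraph d) (hfkg β) hβ h h12 (plusIndicator_mono B)
      (measurable_plusIndicator B)
  have hshift : ∀ L : ℕ, isingExpect (zdGraph d) (box d L) β h .plus (plusIndicator B ∘ configShift v) =
      isingExpect (zdGraph d) ((box d L).map (Site.shift v).toEmbedding) β h .plus (plusIndicator B) :=
    fun L => (isingExpect_plus_shift (box d L) v β h (measurable_plusIndicator B)).symm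
  simp_rw [hshift]
  -- lower bound `a (L + m)`, upper bound `a (L - m)` for `L ≥ m`
  have hlow : Tendsto (fun L => a (L + m)) atTop (𝓝 (plusExpect d β h (plusIndicator B))) :=
    hconv.comp (tendsto_add_atTop_nat m)
  have hup : Tendsto (fun L => a (L - m)) atTop (𝓝 (plusExpect d β h (plusIndicator B))) :=
    hconv.comp (tendsto_sub_atTop_nat m)
  refine tendsto_of_tendsto_of_tendsto_of_le_of_le' hlow hup
    (Eventually.of_forall fun L => hanti (map_shift_box_subset L v)) ?_
  refine eventually_atTop.2 ⟨m, fun L hL => hanti ?_⟩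
  have : box d (L - m + Site.supNorm v) = box d L := by rw [← hm, Nat.sub_add_cancel hL]
  simpa only [this] using box_subset_map_shift_box (L - m) v

/-! ### Translation invariance of the plus state on spin products (Friedli–Velenik, Thm. 3.17) -/

/-- **Translation invariance of the plus state on spin products, from FKG** (Friedli–Velenik 2017,
Thm. 3.17: "`⟨·⟩⁺_{β,h}` is invariant under translations"): for `β ≥ 0`, any `h`, finite `A` and
`v ∈ ℤ^d`, the box sequence of `⟨σ_A ∘ θ_v⟩⁺_{B(L);β,h}` converges to `⟨σ_A⟩⁺_{β,h}`, so that
`plusExpect d β h (σ_A ∘ θ_v) = plusExpect d β h σ_A`, where `(σ_A ∘ θ_v)(σ) = ∏_{x∈A} σ_{x-v}`. [cite: FriedliVelenik2017, Thm. 3.17] -/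
theorem plusExpect_spinProduct_comp_shift (hfkg : ∀ β : ℝ, ising_fkg (zdGraph d) (β := β))
    {β : ℝ} (hβ : 0 ≤ β) (h : ℝ) (A : Finset (Site d)) (v : Site d) :
    plusExpect d β h (spinProduct A ∘ configShift v) = plusExpect d β h (spinProduct A) := by
  classical
  set c : Finset (Site d) → ℝ := fun B => (-1 : ℝ) ^ #(A \ B) * 2 ^ #B with hc
  have hF : spinProduct A ∘ configShift v =
      fun σ => ∑ B ∈ A.powerset, c B * (plusIndicator B ∘ configShift v) σ :=
    funext fun σ => spinProduct_eq_sum_plusIndicator A (configShift v σ)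
  have hmB : ∀ B : Finset (Site d), Measurable (plusIndicator B ∘ configShift v) := fun B =>
    (measurable_plusIndicator B).comp (configShift v).measurable
  have hlin : ∀ L : ℕ, isingExpect (zdGraph d) (box d L) β h .plus (spinProduct A ∘ configShift v) =
      ∑ B ∈ A.powerset, c B *
        isingExpect (zdGraph d) (box d L) β h .plus (plusIndicator B ∘ configShift v) := by
    intro L
    rw [hF, isingExpect_finset_sum' _ _ _ _ β A.powerset
      (fun B σ => c B * (plusIndicator B ∘ configShift v) σ) fun B => (hmB B).const_mul _]
    exact sum_congr rfl fun B _ => isingExpect_const_mul' _ _ _ _ β (c B) (hmB B)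
  have ht : Tendsto (fun L : ℕ => isingExpect (zdGraph d) (box d L) β h .plus
      (spinProduct A ∘ configShift v)) atTop
      (𝓝 (∑ B ∈ A.powerset, c B * plusExpect d β h (plusIndicator B))) := by
    simp_rw [hlin]
    exact tendsto_finsetSum _ fun B _ =>
      (tendsto_isingExpect_plus_plusIndicator_comp_shift hfkg hβ h B v).const_mul _
  -- the unshifted sequence has the same limit
  have hlin₀ : ∀ L : ℕ, isingExpect (zdGraph d) (box d L) β h .plus (spinProduct A) =
      ∑ B ∈ A.powerset, c B * isingExpect (zdGraph d) (box d L) β h .plus (plusIndicator B) := by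
    intro L
    rw [show spinProduct A = fun σ => ∑ B ∈ A.powerset, c B * plusIndicator B σ from
        funext fun σ => spinProduct_eq_sum_plusIndicator A σ,
      isingExpect_finset_sum' _ _ _ _ β A.powerset (fun B σ => c B * plusIndicator B σ)
        fun B => (measurable_plusIndicator B).const_mul _]
    exact sum_congr rfl fun B _ => isingExpect_const_mul' _ _ _ _ β (c B) (measurable_plusIndicator B)
  have ht₀ : Tendsto (fun L : ℕ => isingExpect (zdGraph d) (box d L) β h .plus (spinProduct A)) atTop
      (𝓝 (∑ B ∈ A.powerset, c B * plusExpect d β h (plusIndicator B))) := by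
    simp_rw [hlin₀]
    exact tendsto_finsetSum _ fun B _ =>
      (tendsto_isingExpect_plus_plusIndicator hfkg hβ h B).const_mul _
  change limUnder atTop (fun L : ℕ => isingExpect (zdGraph d) (box d L) β h .plus
      (spinProduct A ∘ configShift v)) =
    limUnder atTop (fun L : ℕ => isingExpect (zdGraph d) (box d L) β h .plus (spinProduct A))
  rw [ht.limUnder_eq, ht₀.limUnder_eq]

/-- **`⟨σ_x⟩⁺_{β,h} = ⟨σ₀⟩⁺_{β,h}`** for `β ≥ 0` and every `h` (translation invariance of the plus
state, Friedli–Velenik 2017, Thm. 3.17), from FKG. [cite: FriedliVelenik2017, Thm. 3.17] -/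
theorem plusExpect_spinAt_eq_plusExpect_spinAt_zero (hfkg : ∀ β : ℝ, ising_fkg (zdGraph d) (β := β))
    {β : ℝ} (hβ : 0 ≤ β) (h : ℝ) (x : Site d) :
    plusExpect d β h (spinAt x) = plusExpect d β h (spinAt 0) := by
  have hs : ∀ z : Site d, spinProduct ({z} : Finset (Site d)) = spinAt z := fun z => by
    funext s; simp [spinProduct]
  have hcomp : spinProduct ({x} : Finset (Site d)) ∘ configShift x = spinAt 0 := by
    funext s
    simp [spinAt, configShift_apply]
  rw [← hs x, ← plusExpect_spinProduct_comp_shift hfkg hβ h {x} x, hcomp]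

/-- **The tree fact `plusExpect_spinAt_eq_spontaneousMagnetization` (`⟨σ_x⟩⁺_β = m*(β)`)
discharged from FKG** (Friedli–Velenik 2017, Thm. 3.17, translation invariance; previously
derived in `MagnetizationContinuity` from the infinite-volume plus measure `exists_plusMeasure`). [cite: FriedliVelenik2017, Thm. 3.17] -/
theorem plusExpect_spinAt_eq_spontaneousMagnetization_of_fkg
    (hfkg : ∀ β : ℝ, ising_fkg (zdGraph d) (β := β)) :
    plusExpect_spinAt_eq_spontaneousMagnetization (d := d) :=
  fun _β hβ x => plusExpect_spinAt_eq_plusExpect_spinAt_zero hfkg hβ 0 x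

/-- **`⟨σ_xσ_y⟩⁺_{β,0} = ⟨σ₀σ_{y-x}⟩⁺_{β,0}`** for `β ≥ 0` (translation invariance of the plus
state on pair correlations, Friedli–Velenik 2017, Thm. 3.17), from FKG. [cite: FriedliVelenik2017, Thm. 3.17] -/
theorem plusPair_eq_twoPointPlus_sub_of_fkg (hfkg : ∀ β : ℝ, ising_fkg (zdGraph d) (β := β))
    {β : ℝ} (hβ : 0 ≤ β) (x y : Site d) : plusPair d β x y = twoPointPlus d β (y - x) := by
  classical
  rcases eq_or_ne x y with rfl | hxy
  · rw [plusPair_self, sub_self, twoPointPlus_zero]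
  have h0 : (0 : Site d) ≠ y - x := fun h => hxy (sub_eq_zero.1 h.symm).symm
  have hcomp : spinProduct ({x, y} : Finset (Site d)) ∘ configShift x = spinProduct {0, y - x} := by
    funext s
    simp only [Function.comp_apply, spinProduct, prod_pair hxy, prod_pair h0, spinAt,
      configShift_apply, sub_self]
  rw [plusPair, twoPointPlus, spinPair_eq_spinProduct hxy, spinPair_eq_spinProduct h0, ← hcomp]
  exact (plusExpect_spinProduct_comp_shift hfkg hβ 0 {x, y} x).symm

/-! ### Unconditional discharges (FKG is the tree theorem `ising_fkg_holds`; the existence of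
the plus state on spin products is the tree theorem `Literature.Probability.LatticeModels.hasBoxLimit_isingCorr_plus_holds`
of `GKSInequalities`, proved there by the GKS route) -/

/-- **The tree fact `plusExpect_spinAt_eq_spontaneousMagnetization` discharged**
(`⟨σ_x⟩⁺_β = m*(β)`, Friedli–Velenik 2017, Thm. 3.17), from `ising_fkg_holds`. [cite: FriedliVelenik2017, Thm. 3.17] -/
theorem plusExpect_spinAt_eq_spontaneousMagnetization_holds :
    plusExpect_spinAt_eq_spontaneousMagnetization (d := d) :=
  plusExpect_spinAt_eq_spontaneousMagnetization_of_fkg fun _ => ising_fkg_holds (zdGraph d)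

/-- **The tree fact `plusExpect_spinAt_mul_le_plusPair` discharged**
(`⟨σ_x⟩⁺⟨σ_y⟩⁺ ≤ ⟨σ_xσ_y⟩⁺`, Aizenman–Duminil-Copin–Sidoravicius 2015, eq. (3.9), FKG in the
plus state), from `ising_fkg_holds` via `MagnetizationContinuity.plusExpect_spinAt_mul_le_plusPair_of_fkg`. [cite: AizenmanDuminilCopinSidoraviciusCMP2015, eq. (3.9)] -/
theorem plusExpect_spinAt_mul_le_plusPair_holds : plusExpect_spinAt_mul_le_plusPair (d := d) :=
  plusExpect_spinAt_mul_le_plusPair_of_fkg (fun _ => ising_fkg_holds (zdGraph d))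
    hasBoxLimit_isingCorr_plus_holds

/-- **`⟨σ_xσ_y⟩⁺_{β,0} = ⟨σ₀σ_{y-x}⟩⁺_{β,0}` unconditionally** (`β ≥ 0`). [cite: FriedliVelenik2017, Thm. 3.17] -/
theorem plusPair_eq_twoPointPlus_sub {β : ℝ} (hβ : 0 ≤ β) (x y : Site d) :
    plusPair d β x y = twoPointPlus d β (y - x) :=
  plusPair_eq_twoPointPlus_sub_of_fkg (fun _ => ising_fkg_holds (zdGraph d)) hβ x y

/-- **The tree fact `twoPointFree_le_twoPointPlus` (`SharpnessProofs`; Friedli–Velenik 2017,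
Exercise 3.25: `⟨σ_iσ_j⟩⁺_{β,0} ≥ ⟨σ_iσ_j⟩^∅_{β,0}`) discharged**: in finite volume
`⟨σ_A⟩^∅_Λ ≤ ⟨σ_A⟩⁺_Λ` (`GKSInequalities.isingCorr_le_isingCorr_plus`), and both box sequences
converge (`hasBoxLimit_isingCorr_free_holds`, `hasBoxLimit_isingCorr_plus_holds`). [cite: FriedliVelenik2017, Exercise 3.25] -/
theorem twoPointFree_le_twoPointPlus_holds : twoPointFree_le_twoPointPlus (d := d) := by
  intro _hd β hβ x
  classical
  refine le_of_tendsto_of_tendsto (tendsto_isingTwoPoint_free hasBoxLimit_isingCorr_free_holds hβ x)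
    (tendsto_isingTwoPoint_plus hasBoxLimit_isingCorr_plus_holds hβ x) ?_
  filter_upwards [eventually_mem_box x] with L hL
  rcases eq_or_ne x 0 with rfl | hx
  · have h1 : spinPair (0 : Site d) 0 = spinProduct (∅ : Finset (Site d)) := by
      funext s; simp [spinPair, spinProduct]
    simp only [isingTwoPoint, h1]
    exact isingCorr_le_isingCorr_plus (zdGraph d) hβ le_rfl .free (Finset.empty_subset _)
  · rw [isingTwoPoint_eq_isingCorr _ _ _ _ _ (Ne.symm hx),
      isingTwoPoint_eq_isingCorr _ _ _ _ _ (Ne.symm hx)]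
    refine isingCorr_le_isingCorr_plus (zdGraph d) hβ le_rfl .free ?_
    intro z hz
    simp only [Finset.mem_insert, Finset.mem_singleton] at hz
    rcases hz with rfl | rfl
    · exact zero_mem_box d L
    · exact hL

end Literature.Probability.LatticeModels
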